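import Mathlib.Analysis.Fourier.FiniteAbelian.PontryaginDuality
import Mathlib.GroupTheory.QuotientGroup.Basic
import Mathlib.GroupTheory.Coset.Card
import Summits.MatrixMultiplication.OmegaCensus.DihedralLawModOneShapeBLemmas
import HarnessLib

/-!
# Characters of finite abelian `2`-groups and the two-point `±` lemma (class N1 of the dicyclic law, part 1)

ω-census `pub-omega`, family (b3), seat pub-omega-group gen 12.  Framing: lottery ticket; floor = certified bounds/negative
ranges.  VALUE: kernel lemmas for the structure theory of TPP triples in dicyclic-type groups (the N1 shape class
`(1,1),(2,2),(k−1,k+1)` of the dicyclic law `3|S||T||U| + 16 = 8|A|`, `pub-omega-group-g11/FAMILY-B-ADDENDUM-g11.md` §2);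
NOT progress on ω.

* `exists_pow_two_pow_eq_neg_one`: a complex number `ζ ≠ 1` with `ζ^(2^m) = 1` has a power `ζ^(2^j) = −1`.
* `exists_addChar_eq_one_eq_neg_one`: in a finite abelian group `B` with `2^m · B = 0`, for `ι` with `2ι = 0` and
  `x ∉ {0, ι}` there is a character `χ` with `χ ι = 1` and `χ x = −1` (a character of `B/⟨ι⟩` separating `x`, raised to a
  suitable power `2^j`).
* **`eq_or_eq_neg_of_two_point`** (the `±` lemma): `B` as above, `P ≠ P'`, `f₀, f₁ ≠ 0`; if for every character `χ`
  `(χ P + χ P')(1 − χ(f₁ − f₀))(1 − χ(f₁ + f₀)) = 0` and `χ f₁ = −1 ⇒ χ P + χ P' = 0`, then `f₁ = f₀` or `f₁ = −f₀`.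
  (Fourier inversion `two_point_inversion` leaves only `P' = P + (f₁ ∓ f₀)` with `2(f₁ ∓ f₀) = 0`; a character trivial at
  `f₁ ∓ f₀` and `−1` at `f₁` then gives `2χ P = 0`.)
In an N1-class dicyclic-law triple the two differences `ē₀, ē₁` of the parts of `T`, read in `A/⟨c₀⟩`, satisfy these
identities (vertex tilings `000`, `010` and the packing at `001`; `DicyclicN1Core.lean`), so `ē₁ = ±ē₀` — the analogue of
the dihedral shape-B step `t' = ±t` of `DihedralLawModOneShapeBCore.lean`.
-/

namespace Summit.MatrixMultiplication.OmegaCensus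

open Finset

section TwoGroupChars

variable {B : Type} [AddCommGroup B] [Fintype B] [DecidableEq B]

/-- A complex `ζ ≠ 1` with `ζ ^ (2^m) = 1` has some `ζ ^ (2^j) = −1`. [folklore] -/
theorem exists_pow_two_pow_eq_neg_one {ζ : ℂ} : ∀ {m : ℕ}, ζ ^ (2 ^ m) = 1 → ζ ≠ 1 → ∃ j : ℕ, ζ ^ (2 ^ j) = -1
  | 0, h, h1 => absurd (by simpa using h) h1
  | m + 1, h, h1 => by
      have hsq : (ζ ^ (2 ^ m)) ^ 2 = 1 := by rw [← pow_mul, ← pow_succ, h]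
      rcases sq_eq_one_iff.1 hsq with h' | h'
      · exact exists_pow_two_pow_eq_neg_one h' h1
      · exact ⟨m, h'⟩

omit [Fintype B] [DecidableEq B] in
/-- Values of a character are non-zero. [folklore] -/
theorem addChar_apply_ne_zero (χ : AddChar B ℂ) (b : B) : χ b ≠ 0 := fun h => by
  have := addChar_mul_neg χ b
  rw [h, zero_mul] at this
  exact zero_ne_one this

omit [DecidableEq B] in
/-- **A character trivial at an involution and `−1` at a given point.**  `2^m · B = 0`, `ι + ι = 0`, `x ≠ 0`, `x ≠ ι`:
there is `χ : AddChar B ℂ` with `χ ι = 1` and `χ x = −1`. [folklore] -/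
theorem exists_addChar_eq_one_eq_neg_one {m : ℕ} (hB : ∀ b : B, (2 ^ m) • b = 0) {ι x : B} (hι : ι + ι = 0)
    (hx0 : x ≠ 0) (hxι : x ≠ ι) : ∃ χ : AddChar B ℂ, χ ι = 1 ∧ χ x = -1 := by
  classical
  set H := AddSubgroup.zmultiples ι with hH
  have hxH : x ∉ H := by
    intro hx
    obtain ⟨k, hk⟩ := AddSubgroup.mem_zmultiples_iff.1 hx
    rcases Int.even_or_odd k with ⟨j, rfl⟩ | ⟨j, rfl⟩
    · apply hx0
      rw [← hk, add_zsmul, ← zsmul_add, hι, zsmul_zero]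
    · apply hxι
      rw [← hk, add_zsmul, one_zsmul, mul_comm, mul_zsmul, two_zsmul, hι, zsmul_zero, zero_add]
  have hx' : ((x : B ⧸ H)) ≠ 0 := fun h => hxH ((QuotientAddGroup.eq_zero_iff x).1 h)
  obtain ⟨χ', hχ'⟩ := AddChar.exists_apply_ne_zero.2 hx'
  set ψ : AddChar B ℂ := χ'.compAddMonoidHom (QuotientAddGroup.mk' H) with hψ
  have hψι : ψ ι = 1 := by
    rw [hψ, AddChar.compAddMonoidHom_apply, QuotientAddGroup.mk'_apply,
      (QuotientAddGroup.eq_zero_iff ι).2 (AddSubgroup.mem_zmultiples ι), AddChar.map_zero_eq_one]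
  have hψx : ψ x ≠ 1 := by
    rw [hψ, AddChar.compAddMonoidHom_apply, QuotientAddGroup.mk'_apply]; exact hχ'
  have hpow : (ψ x) ^ (2 ^ m) = 1 := by
    rw [← AddChar.map_nsmul_eq_pow, hB, AddChar.map_zero_eq_one]
  obtain ⟨j, hj⟩ := exists_pow_two_pow_eq_neg_one hpow hψx
  refine ⟨ψ ^ (2 ^ j), ?_, ?_⟩
  · rw [AddChar.pow_apply, hψι, one_pow]
  · rw [AddChar.pow_apply, hj]

/-- **The `±` lemma.**  `2^m · B = 0`, `P ≠ P'`, `f₀ ≠ 0 ≠ f₁`; suppose that for every character `χ` of `B`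
`(χ P + χ P')·(1 − χ(f₁ − f₀))·(1 − χ(f₁ + f₀)) = 0`, and that `χ f₁ = −1` forces `χ P + χ P' = 0`.  Then `f₁ = f₀` or
`f₁ = −f₀`. [folklore] -/
theorem eq_or_eq_neg_of_two_point {m : ℕ} (hB : ∀ b : B, (2 ^ m) • b = 0) {P P' f₀ f₁ : B} (hPP : P ≠ P')
    (hf₀ : f₀ ≠ 0) (hf₁ : f₁ ≠ 0)
    (hinv : ∀ χ : AddChar B ℂ, (χ P + χ P') * ((1 - χ (f₁ - f₀)) * (1 - χ (f₁ + f₀))) = 0)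
    (hpar : ∀ χ : AddChar B ℂ, χ f₁ = -1 → χ P + χ P' = 0) : f₁ = f₀ ∨ f₁ = -f₀ := by
  by_contra hcon
  obtain ⟨hne₁, hne₂⟩ := not_or.1 hcon
  set U := f₁ - f₀ with hU
  set V := f₁ + f₀ with hV
  have hU0 : U ≠ 0 := fun h => hne₁ (sub_eq_zero.1 h)
  have hV0 : V ≠ 0 := fun h => hne₂ (eq_neg_of_add_eq_zero_left h)
  have I1 := two_point_inversion hinv P
  have I2 := two_point_inversion hinv P'
  have nPU : ¬ (P + U = P) := fun h => hU0 (add_left_cancel (h.trans (add_zero P).symm))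
  have nPV : ¬ (P + V = P) := fun h => hV0 (add_left_cancel (h.trans (add_zero P).symm))
  have nP'U : ¬ (P' + U = P') := fun h => hU0 (add_left_cancel (h.trans (add_zero P').symm))
  have nP'V : ¬ (P' + V = P') := fun h => hV0 (add_left_cancel (h.trans (add_zero P').symm))
  have hP'P : ¬ (P' = P) := fun h => hPP h.symm
  rw [if_pos rfl, if_neg nPU, if_neg nPV, if_neg hP'P] at I1
  rw [if_neg hPP, if_pos rfl, if_neg nP'U, if_neg nP'V] at I2
  -- the surviving configurations
  have key : (P' = P + U ∧ U + U = 0) ∨ (P' = P + V ∧ V + V = 0) := by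
    by_cases hUV : U + V = 0
    · -- then both `P' + U = P` and `P' + V = P`
      have e1 : P + U + V = P := by rw [add_assoc, hUV, add_zero]
      have e2 : P' + U + V = P' := by rw [add_assoc, hUV, add_zero]
      have n2 : ¬ (P' + U + V = P) := by rw [e2]; exact hP'P
      rw [if_pos e1, if_neg n2] at I1
      have h1 : P' + U = P := by by_contra h; rw [if_neg h] at I1; split_ifs at I1 <;> omega
      have h2 : P' + V = P := by by_contra h; rw [if_neg h] at I1; omega
      have hUV' : U = V := add_left_cancel (h1.trans h2.symm)
      have h2U : U + U = 0 := by nth_rewrite 2 [hUV']; exact hUV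
      left
      refine ⟨?_, h2U⟩
      calc P' = P' + U + U := by rw [add_assoc, h2U, add_zero]
        _ = P + U := by rw [h1]
    · have n1 : ¬ (P + U + V = P) := fun h => hUV (add_left_cancel ((add_assoc P U V).symm.trans
        (h.trans (add_zero P).symm)))
      have n2 : ¬ (P' + U + V = P') := fun h => hUV (add_left_cancel ((add_assoc P' U V).symm.trans
        (h.trans (add_zero P').symm)))
      rw [if_neg n1] at I1
      rw [if_neg n2] at I2
      -- from `I1`: exactly one of `P' + U = P`, `P' + V = P`; from `I2`: one of `P + U = P'`, `P + V = P'`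
      by_cases a1 : P' + U = P
      · have nb1 : ¬ (P' + V = P) := by
          intro h
          rw [if_pos a1, if_pos h] at I1
          have h3 : P' + U + V = P := by by_contra h3; rw [if_neg h3] at I1; omega
          rw [a1] at h3
          exact nPV h3
        by_cases a2 : P + U = P'
        · left
          refine ⟨a2.symm, ?_⟩
          have : P + (U + U) = P := by rw [← add_assoc, a2, a1]
          exact add_left_cancel (this.trans (add_zero P).symm)
        · have b2 : P + V = P' := by
            by_contra h; rw [if_neg a2, if_neg h] at I2; split_ifs at I2 <;> omega
          exfalso; apply hUV
          have : P' + (U + V) = P' := by rw [← add_assoc, a1, b2]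
          exact add_left_cancel (this.trans (add_zero P').symm)
      · have b1 : P' + V = P := by
          by_contra h; rw [if_neg a1, if_neg h] at I1; split_ifs at I1 <;> omega
        by_cases a2 : P + U = P'
        · exfalso; apply hUV
          have : P' + (V + U) = P' := by rw [← add_assoc, b1, a2]
          rw [add_comm V U] at this
          exact add_left_cancel (this.trans (add_zero P').symm)
        · have b2 : P + V = P' := by
            by_contra h; rw [if_neg a2, if_neg h] at I2; split_ifs at I2 <;> omega
          right
          refine ⟨b2.symm, ?_⟩
          have : P + (V + V) = P := by rw [← add_assoc, b2, b1]
          exact add_left_cancel (this.trans (add_zero P).symm)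
  -- kill both configurations with a character `χ(f₁ ∓ f₀) = 1`, `χ f₁ = −1`
  rcases key with ⟨hr, h2⟩ | ⟨hr, h2⟩
  · have hx : f₁ ≠ U := by
      intro h; apply hf₀
      have : f₁ - f₀ = f₁ - 0 := by rw [sub_zero]; exact h.symm
      exact sub_right_injective this
    obtain ⟨χ, hχU, hχ1⟩ := exists_addChar_eq_one_eq_neg_one hB h2 hf₁ hx
    have h0 := hpar χ hχ1
    rw [hr, AddChar.map_add_eq_mul, hχU, mul_one, ← two_mul] at h0
    exact addChar_apply_ne_zero χ P ((mul_eq_zero.1 h0).resolve_left two_ne_zero)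
  · have hx : f₁ ≠ V := by
      intro h; apply hf₀
      have : f₁ + f₀ = f₁ + 0 := by rw [add_zero]; exact h.symm
      exact add_left_cancel this
    obtain ⟨χ, hχV, hχ1⟩ := exists_addChar_eq_one_eq_neg_one hB h2 hf₁ hx
    have h0 := hpar χ hχ1
    rw [hr, AddChar.map_add_eq_mul, hχV, mul_one, ← two_mul] at h0
    exact addChar_apply_ne_zero χ P ((mul_eq_zero.1 h0).resolve_left two_ne_zero)

end TwoGroupChars

end Summit.MatrixMultiplication.OmegaCensus
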